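import Summits.BirchSwinnertonDyer.BirchSwinnertonDyer.Theorems.EdixhovenFibreFiveSevenReceptacleOfKatoClause
import Summits.BirchSwinnertonDyer.BirchSwinnertonDyer.Theorems.EdixhovenFibreFiveSevenStarredOptimalManinUnitFiveSevenReceptacleExit
import Summits.BirchSwinnertonDyer.BirchSwinnertonDyer.Theorems.KimAtThreeFineKatoKPortJunction
import Summits.BirchSwinnertonDyer.BirchSwinnertonDyer.Theorems.KimAtThreeFineKatoKPortJunctionDegree
import Mathlib.NumberTheory.NumberField.Cyclotomic.Ideal
import HarnessLib

/-!
# The receptacle of F″ AT THE CYCLOTOMIC COMPLETIONS `K_w = ℚ(ζ_m)_w`, `w ∣ p ∤ m`, under F″'s clause as TYPED —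
# `7 < p ∨ (Nat.Coprime (orderOf (p : ZMod m)) (p − 1) ∧ ∀ P : (V ⊗ ℚ_p)(ℚ_p), p • P = 0 → P = 0)` —
# and the receptacle EXIT `‖a‖ ≤ 1`

Route `EdixhovenFibreFiveSeven`, crux K★ `StarredOptimalManinUnitFiveSeven` (stmt-BirchSwinnertonDyer-22226),
line `kato-lever`, seat `bsd-line-edix-p2` g4; `--supports` 22226 (helper toward the ONE open stub F″ =
`Literature.NumberTheory.EllipticCurves.kato_neron_isIntegral_twistedSymbolSum_of_additive_five_le`, programme
pieces P2/P3/P4 of `Cruxes/StarredOptimalManinUnitFiveSeven/Lines/kato-lever-F2-programme.md`). TOOL theorems only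
(no definition, no named fact, no `sorry`); nothing is closed or booked; BSD is not proved by any of this.

WHY. F″'s receptacle (Kim–Nakamura Cor. 2.4) is applied at the completions `K_w` of `L = ℚ(ζ_m)` at `w ∣ p`,
`(m, p) = 1`; its side clause is typed with `orderOf (p : ZMod m)`. The abstract receptacle under the clause
`7 < p ∨ (Nat.Coprime (Module.finrank ℚ_[p] K) (p − 1) ∧ …)` is this seat's p598658 (`…ReceptacleOfKatoClause`);
the K-port junction (seat w2-kport: `KPort.Kw p L w` = `L_w` re-normed with `‖p‖ = p⁻¹`, a complete ultrametric
finite-dimensional normed `ℚ_p`-algebra, Galois for cyclotomic `L`, unramified for `p ∤ m`) supplies `K := K_w`.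
THIS file supplies the one missing identification **`[K_w : ℚ_p] = ord_m p`** (Mathlib
`IsCyclotomicExtension.Rat.inertiaDeg_eq_of_not_dvd`: `f(w∣p) = orderOf (p : ZMod m)` over `ℤ`; `f` over `𝓞 ℚ`
equals `f` over `ℤ`; kport `Kw.finrank_eq_inertiaDeg`: `[K_w : ℚ_p] = f(w∣p)` for `e = 1`), so that F″'s clause
VERBATIM feeds the receptacle at `K_w`, and composes the EXIT (seat edix-p5's p598030
`StarredOptimalManinUnitFiveSevenReceptacle.norm_le_one_of_forall_point`: P2 ⊕ P3) with the clause: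
**for every `a ∈ K_w` in the (S5b)-range — `‖Tr_{K_w/ℚ_p}(a · log_ω P)‖ ≤ 1` for all `P ∈ E(K_w)` — `‖a‖ ≤ 1`.**
That is item 2 of F″'s derivation (`exp*_{ω_E}(loc_w z) ∈ 𝒪_w`) as a THEOREM modulo (S5b), at every datum
`(V, p ≥ 5 additive, m coprime to p, w ∣ p)` F″ quantifies over, for the minimal model of `V`.

* §1 `inertiaDeg_ringOfIntegersRat_eq_one`, `inertiaDeg_ringOfIntegersRat_eq_inertiaDeg_int` (tower `ℤ → 𝓞 ℚ → 𝓞 L`),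
  **`inertiaDeg_eq_orderOf_of_isCyclotomicExtension`** (`f(w∣p) = ord_m p` over `𝓞 ℚ`),
  **`finrank_Kw_eq_orderOf`** (`[K_w : ℚ_p] = ord_m p`, `p ∤ m`).
* §2 EXIT under F″'s clause, abstract `K`: `norm_le_one_of_forall_point_of_katoClause` (any additive `M/ℤ_p`),
  `norm_le_one_of_forall_point_of_addv_of_katoClause` (`W_ℤ ⊗ K`), and the (S5b)-socket forms
  `forall_norm_le_one_of_range_iff_forall_point_of_{katoClause,addv_of_katoClause}`.
* §3 AT `K_w`, `L/ℚ` `{m}`-cyclotomic, `p ∤ m`, `e(w∣p) = 1`: `noPTorsion_Kw_of_katoClause` (`E₀(K_w)[p] = 0`),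
  ★ `exists_mem_nonsingularReductionSubgroup_satLog_eq_Kw_of_katoClause` (`Λ̃ : E₀(K_w) ↠ 𝒪_w`),
  ★ `norm_le_one_of_forall_point_Kw_of_katoClause` (the EXIT at `K_w`), `forall_norm_le_one_of_range_iff_forall_point_Kw_of_katoClause`
  — all with F″'s binders `5 ≤ p`, `Addv W p`, `¬ p ∣ m`,
  `7 < p ∨ (Nat.Coprime (orderOf (p : ZMod m)) (p − 1) ∧ ∀ P : (W.baseChange ℚ_[p]).Point, p • P = 0 → P = 0)`.

References: [KimNakamura2020] C.-H. Kim, K. Nakamura, J. Number Theory 210 (2020), Thm. 2.1, Cor. 2.4, Remark 1.8 (1);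
[KostersPannekoek2017] M. Kosters, R. Pannekoek, arXiv:1703.07888, Thm. 1 (`K/ℚ_p` unramified of degree `n`,
`N_{k/𝔽_p}(ū) = ūⁿ`); [Washington1997] L. C. Washington, *Introduction to Cyclotomic Fields*, Thm. 2.13 (`p ∤ m`
splits in `ℚ(ζ_m)` into primes of residue degree `ord_m p`, unramified); [CasselsFrohlichANT1967] Ch. II §10
(`[L_w : K_v] = e f`); [Kato2004Asterisque] K. Kato, Astérisque 295, (8.1.3), Thm. 9.7 (the consumer F″).
-/

set_option autoImplicit false
-- the Theorems namespace of a single-conjunct summit repeats the summit name by design (D-0017)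
set_option linter.dupNamespace false

noncomputable section

open scoped Classical NNReal NumberField
open WeierstrassCurve Literature.NumberTheory.EllipticCurves Literature.NumberTheory.EllipticCurves.FormalGroupChart
open Summit.BirchSwinnertonDyer.Rank1Residual.Additive
open Summit.BirchSwinnertonDyer.Rank1Residual.Additive.BallEval
open Summit.BirchSwinnertonDyer.BirchSwinnertonDyer.Theorems.KPort
open Summit.BirchSwinnertonDyer.BirchSwinnertonDyer.Theorems.StarredOptimalManinUnitFiveSevenReceptacle
open Literature.NumberTheory.GaloisRepresentations.LubinTate (unitBall mem_unitBall_iff)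
open IsDedekindDomain NumberField

namespace Summit.BirchSwinnertonDyer.BirchSwinnertonDyer.Theorems.ReceptacleTorsion

/-! ## §1 `[K_w : ℚ_p] = ord_m p` for `L = ℚ(ζ_m)`, `w ∣ p ∤ m` -/

section Degree

/-- A maximal ideal of `𝓞 ℚ` has residue degree `1` over `ℤ` (`ℤ/(p) → 𝓞 ℚ/𝔭` is onto, hence an isomorphism of
fields). [folklore] -/
theorem inertiaDeg_ringOfIntegersRat_eq_one (Q : Ideal (𝓞 ℚ)) [Q.IsMaximal] : Q.inertiaDeg ℤ = 1 := by
  haveI : (Q.under ℤ).IsMaximal := Ideal.IsMaximal.under ℤ Q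
  rw [← Ideal.inertiaDeg'_eq_inertiaDeg (Q.under ℤ) Q, Ideal.inertiaDeg'_algebraMap]
  letI : Field (ℤ ⧸ Q.under ℤ) := Ideal.Quotient.field _
  letI : Field (𝓞 ℚ ⧸ Q) := Ideal.Quotient.field _
  have hsurj : Function.Surjective (algebraMap (ℤ ⧸ Q.under ℤ) (𝓞 ℚ ⧸ Q)) := by
    intro y
    obtain ⟨y, rfl⟩ := Ideal.Quotient.mk_surjective y
    obtain ⟨x, rfl⟩ := Rat.int_algebraMap_surjective (𝓞 ℚ) y
    exact ⟨Ideal.Quotient.mk _ x, rfl⟩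
  have e : (ℤ ⧸ Q.under ℤ) ≃ₗ[ℤ ⧸ Q.under ℤ] (𝓞 ℚ ⧸ Q) :=
    LinearEquiv.ofBijective (Algebra.linearMap (ℤ ⧸ Q.under ℤ) (𝓞 ℚ ⧸ Q))
      ⟨(algebraMap (ℤ ⧸ Q.under ℤ) (𝓞 ℚ ⧸ Q)).injective, hsurj⟩
  rw [← e.finrank_eq, Module.finrank_self]

/-- The residue degree of a maximal ideal `q` of `𝓞 L` over `𝓞 ℚ` is its residue degree over `ℤ` (tower
`ℤ → 𝓞 ℚ → 𝓞 L`). [folklore] -/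
theorem inertiaDeg_ringOfIntegersRat_eq_inertiaDeg_int {L : Type*} [Field L] [NumberField L] (q : Ideal (𝓞 L))
    [q.IsMaximal] : q.inertiaDeg (𝓞 ℚ) = q.inertiaDeg ℤ := by
  haveI : (q.under (𝓞 ℚ)).IsMaximal := Ideal.IsMaximal.under (𝓞 ℚ) q
  rw [Ideal.inertiaDeg_tower (R := ℤ) (q.under (𝓞 ℚ)) q, inertiaDeg_ringOfIntegersRat_eq_one, one_mul]

variable (p : ℕ) [hp : Fact p.Prime] (L : Type) [Field L] [NumberField L]
  (w : ((Rat.HeightOneSpectrum.primesEquiv (R := 𝓞 ℚ)).symm ⟨p, hp.out⟩).Extension (𝓞 L))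

/-- **`f(w∣p) = ord_m p`** for a place `w` of an `{m}`-cyclotomic number field `L` above `p ∤ m` (residue degree over
`𝓞 ℚ`): Mathlib's `IsCyclotomicExtension.Rat.inertiaDeg_eq_of_not_dvd` (over `ℤ`) and the tower.
[cite: Washington1997, Thm. 2.13] -/
theorem inertiaDeg_eq_orderOf_of_isCyclotomicExtension (m : ℕ) [NeZero m] [IsCyclotomicExtension {m} ℚ L]
    (hpm : ¬ p ∣ m) : w.1.asIdeal.inertiaDeg (𝓞 ℚ) = orderOf (p : ZMod m) := by
  have hwv : w.1.asIdeal.under (𝓞 ℚ) =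
      ((Rat.HeightOneSpectrum.primesEquiv (R := 𝓞 ℚ)).symm ⟨p, hp.out⟩).asIdeal :=
    congrArg HeightOneSpectrum.asIdeal w.2
  have hnat : Rat.HeightOneSpectrum.natGenerator ((Rat.HeightOneSpectrum.primesEquiv (R := 𝓞 ℚ)).symm ⟨p, hp.out⟩) = p :=
    congrArg Subtype.val ((Rat.HeightOneSpectrum.primesEquiv (R := 𝓞 ℚ)).apply_symm_apply ⟨p, hp.out⟩)
  -- `p ∈ w`
  have hpv : ((p : ℕ) : 𝓞 ℚ) ∈ ((Rat.HeightOneSpectrum.primesEquiv (R := 𝓞 ℚ)).symm ⟨p, hp.out⟩).asIdeal := by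
    rw [Literature.NumberTheory.DiophantineGeometry.UniformABCConjecture.asIdeal_eq_span_natGenerator _, hnat]
    exact Ideal.mem_span_singleton_self _
  have hpw : ((p : ℕ) : 𝓞 L) ∈ w.1.asIdeal := by
    have h : ((p : ℕ) : 𝓞 ℚ) ∈ w.1.asIdeal.under (𝓞 ℚ) := by rw [hwv]; exact hpv
    rw [Ideal.under_def, Ideal.mem_comap, map_natCast] at h
    exact h
  -- `w` lies over `(p) ⊆ ℤ`
  haveI := w.1.isMaximal
  haveI : w.1.asIdeal.LiesOver (Ideal.span {(p : ℤ)}) := by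
    refine ⟨?_⟩
    have hle : Ideal.span {(p : ℤ)} ≤ w.1.asIdeal.under ℤ := by
      rw [Ideal.span_le, Set.singleton_subset_iff, SetLike.mem_coe, Ideal.under_def, Ideal.mem_comap, map_natCast]
      exact hpw
    have hprime : (Ideal.span {(p : ℤ)}).IsPrime :=
      (Ideal.span_singleton_prime (by exact_mod_cast hp.out.ne_zero)).mpr (Nat.prime_iff_prime_int.mp hp.out)
    have hmax : (Ideal.span {(p : ℤ)}).IsMaximal := hprime.isMaximal (by simp [hp.out.ne_zero])
    exact (hmax.eq_of_le (Ideal.comap_ne_top _ w.1.isPrime.ne_top) hle)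
  rw [inertiaDeg_ringOfIntegersRat_eq_inertiaDeg_int]
  exact IsCyclotomicExtension.Rat.inertiaDeg_eq_of_not_dvd p L w.1.asIdeal hpm

/-- **`[K_w : ℚ_p] = ord_m p`** for the completion `K_w = KPort.Kw p L w` of an `{m}`-cyclotomic `L` at `w ∣ p ∤ m`
(`e(w∣p) = 1`, `[K_w : ℚ_p] = e·f = f = ord_m p`). [cite: Washington1997, Thm. 2.13] [cite: CasselsFrohlichANT1967, Ch. II §10] -/
theorem finrank_Kw_eq_orderOf (m : ℕ) [NeZero m] [IsCyclotomicExtension {m} ℚ L] (hpm : ¬ p ∣ m) :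
    Module.finrank ℚ_[p] (Kw p L w) = orderOf (p : ZMod m) := by
  rw [Kw.finrank_eq_inertiaDeg p L w (Kw.ramificationIdx_eq_one_of_isCyclotomicExtension m hpm),
    inertiaDeg_eq_orderOf_of_isCyclotomicExtension p L w m hpm]

end Degree

/-! ## §2 The receptacle EXIT `‖a‖ ≤ 1` under F″'s clause (abstract unramified Galois `K`) -/

section Exit

variable {p : ℕ} [hp : Fact p.Prime] {K : Type*} [NontriviallyNormedField K] [NormedAlgebra ℚ_[p] K]
  [IsUltrametricDist K] [CompleteSpace K] [FiniteDimensional ℚ_[p] K] [IsGalois ℚ_[p] K]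

section Model

variable {M : WeierstrassCurve ℤ_[p]} [hE : (M.map PadicInt.Coe.ringHom).IsElliptic]
  [hint : (curveK p K M).IsIntegral (NormedField.valuation (K := K)).integer]

/-- ★ **RECEPTACLE EXIT under F″'s clause.** `M/ℤ_p` with `‖Δ‖, ‖c₄‖ < 1` (additive), `5 ≤ p`, `K/ℚ_p` finite Galois
UNRAMIFIED, `7 < p ∨ (gcd([K : ℚ_p], p − 1) = 1 ∧ (M ⊗ ℚ_p)(ℚ_p)[p] = 0)`: if `‖Tr_{K/ℚ_p}(a · log_ω P)‖ ≤ 1` for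
every `P ∈ E(K)`, then `‖a‖ ≤ 1` (seat edix-p5's P2 ⊕ P3 exit with its torsion hypothesis discharged by p598658).
[cite: KimNakamura2020, Cor. 2.4] [cite: KostersPannekoek2017, Thm. 1 and Cor. 2] -/
theorem norm_le_one_of_forall_point_of_katoClause (hp5 : 5 ≤ p) (hK : ∀ z : K, ‖z‖ < 1 → ‖z‖ ≤ ‖(p : K)‖)
    (hΔ : ‖M.Δ‖ < 1) (hc₄ : ‖M.c₄‖ < 1)
    (hcl : 7 < p ∨ (Nat.Coprime (Module.finrank ℚ_[p] K) (p - 1) ∧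
      ∀ P₀ : (M.map PadicInt.Coe.ringHom).toAffine.Point, p • P₀ = 0 → P₀ = 0))
    {a : K}
    (ha : ∀ P : (curveK p K M).toAffine.Point,
      ‖Algebra.trace ℚ_[p] K (a * padicLogPointFiniteExt (NormedField.valuation (K := K)) (curveK p K M) p P)‖ ≤ 1) :
    ‖a‖ ≤ 1 :=
  norm_le_one_of_forall_point (by omega) hK hΔ hc₄
    (fun _ hP hpP => noPTorsion_of_katoClause hp5 hK hΔ hc₄ hcl hP hpP) ha

/-- (S5b)-socket form: under the same hypotheses any `Φ : X → K` whose range is characterised by the trace condition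
(the literal shape of `PAdicHodge.exists_smul_range_expStarCoord_iff_trace_log` for `M ⊗ K`) takes values in `𝒪_K` —
`exp*_{e•ω}(H¹(K, T_pE)) ⊆ 𝒪_K`. [cite: KimNakamura2020, Cor. 2.4] [cite: BlochKato1990, Prop. 3.8 (p. 354)] -/
theorem forall_norm_le_one_of_range_iff_forall_point_of_katoClause (hp5 : 5 ≤ p)
    (hK : ∀ z : K, ‖z‖ < 1 → ‖z‖ ≤ ‖(p : K)‖) (hΔ : ‖M.Δ‖ < 1) (hc₄ : ‖M.c₄‖ < 1)
    (hcl : 7 < p ∨ (Nat.Coprime (Module.finrank ℚ_[p] K) (p - 1) ∧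
      ∀ P₀ : (M.map PadicInt.Coe.ringHom).toAffine.Point, p • P₀ = 0 → P₀ = 0))
    {X : Type*} (Φ : X → K)
    (hΦ : ∀ a : K, (∃ x, Φ x = a) ↔ ∀ P : (curveK p K M).toAffine.Point,
      ‖Algebra.trace ℚ_[p] K (a * padicLogPointFiniteExt (NormedField.valuation (K := K)) (curveK p K M) p P)‖ ≤ 1)
    (x : X) : ‖Φ x‖ ≤ 1 :=
  norm_le_one_of_forall_point_of_katoClause hp5 hK hΔ hc₄ hcl ((hΦ (Φ x)).mp ⟨x, rfl⟩)

end Model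

section Rat

variable (W : WeierstrassCurve ℚ) [W.IsElliptic] [W.IsGloballyMinimal]
  [(curveK p K ((integralModelInt W).map (Int.castRingHom ℤ_[p]))).IsIntegral (NormedField.valuation (K := K)).integer]

/-- ★ **RECEPTACLE EXIT for `W_ℤ ⊗ K` under F″'s clause** (`W/ℚ` globally minimal, `Addv W p`, `5 ≤ p`, `K/ℚ_p` finite
Galois unramified, clause read on `W.baseChange ℚ_[p]`): `‖Tr(a · log_ω P)‖ ≤ 1` for all `P ∈ E(K)` ⟹ `‖a‖ ≤ 1`.
[cite: KimNakamura2020, Cor. 2.4] [cite: KostersPannekoek2017, Thm. 1 and Cor. 2] -/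
theorem norm_le_one_of_forall_point_of_addv_of_katoClause (hp5 : 5 ≤ p) (hadd : Rank1Residual.Addv W p)
    (hK : ∀ z : K, ‖z‖ < 1 → ‖z‖ ≤ ‖(p : K)‖)
    (hcl : 7 < p ∨ (Nat.Coprime (Module.finrank ℚ_[p] K) (p - 1) ∧
      ∀ P : (W.baseChange ℚ_[p]).toAffine.Point, p • P = 0 → P = 0))
    {a : K}
    (ha : ∀ P : (curveK p K ((integralModelInt W).map (Int.castRingHom ℤ_[p]))).toAffine.Point,
      ‖Algebra.trace ℚ_[p] K (a * padicLogPointFiniteExt (NormedField.valuation (K := K))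
        (curveK p K ((integralModelInt W).map (Int.castRingHom ℤ_[p]))) p P)‖ ≤ 1) :
    ‖a‖ ≤ 1 := by
  haveI := isElliptic_map_integralModelInt_padic (p := p) W
  obtain ⟨hΔ, hc₄⟩ := norm_Δ_lt_one_of_addv (p := p) W hadd
  exact norm_le_one_of_forall_point (by omega) hK hΔ hc₄
    (fun _ hP hpP => noPTorsion_of_addv_of_katoClause W hp5 hadd hK hcl hP hpP) ha

/-- (S5b)-socket form for `W_ℤ ⊗ K` under F″'s clause: any `Φ : X → K` with range characterised by the trace condition
takes values in `𝒪_K`. [cite: KimNakamura2020, Cor. 2.4] -/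
theorem forall_norm_le_one_of_range_iff_forall_point_of_addv_of_katoClause (hp5 : 5 ≤ p)
    (hadd : Rank1Residual.Addv W p) (hK : ∀ z : K, ‖z‖ < 1 → ‖z‖ ≤ ‖(p : K)‖)
    (hcl : 7 < p ∨ (Nat.Coprime (Module.finrank ℚ_[p] K) (p - 1) ∧
      ∀ P : (W.baseChange ℚ_[p]).toAffine.Point, p • P = 0 → P = 0))
    {X : Type*} (Φ : X → K)
    (hΦ : ∀ a : K, (∃ x, Φ x = a) ↔
      ∀ P : (curveK p K ((integralModelInt W).map (Int.castRingHom ℤ_[p]))).toAffine.Point,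
        ‖Algebra.trace ℚ_[p] K (a * padicLogPointFiniteExt (NormedField.valuation (K := K))
          (curveK p K ((integralModelInt W).map (Int.castRingHom ℤ_[p]))) p P)‖ ≤ 1)
    (x : X) : ‖Φ x‖ ≤ 1 :=
  norm_le_one_of_forall_point_of_addv_of_katoClause W hp5 hadd hK hcl ((hΦ (Φ x)).mp ⟨x, rfl⟩)

end Rat

end Exit

/-! ## §3 AT THE CYCLOTOMIC COMPLETIONS `K_w`, under F″'s clause as typed (`orderOf (p : ZMod m)`) -/

section Cyclotomic

variable (p : ℕ) [hp : Fact p.Prime] (L : Type) [Field L] [NumberField L]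
  (w : ((Rat.HeightOneSpectrum.primesEquiv (R := 𝓞 ℚ)).symm ⟨p, hp.out⟩).Extension (𝓞 L))
  [he : Fact (w.1.asIdeal.ramificationIdx (𝓞 ℚ) = 1)]
  (W : WeierstrassCurve ℚ) [W.IsElliptic] [W.IsGloballyMinimal]
  [hint : (curveK p (Kw p L w) ((integralModelInt W).map (Int.castRingHom ℤ_[p]))).IsIntegral
    (NormedField.valuation (K := Kw p L w)).integer]

omit hint [W.IsElliptic] [W.IsGloballyMinimal] in
/-- F″'s clause, typed with `orderOf (p : ZMod m)`, IS the abstract clause at `K := K_w` (`[K_w : ℚ_p] = ord_m p`).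
[cite: Washington1997, Thm. 2.13] -/
theorem katoClause_Kw_of_katoClause (m : ℕ) [NeZero m] [IsCyclotomicExtension {m} ℚ L] (hpm : ¬ p ∣ m)
    (hcl : 7 < p ∨ (Nat.Coprime (orderOf (p : ZMod m)) (p - 1) ∧
      ∀ P : (W.baseChange ℚ_[p]).toAffine.Point, p • P = 0 → P = 0)) :
    7 < p ∨ (Nat.Coprime (Module.finrank ℚ_[p] (Kw p L w)) (p - 1) ∧
      ∀ P : (W.baseChange ℚ_[p]).toAffine.Point, p • P = 0 → P = 0) := by
  rw [finrank_Kw_eq_orderOf p L w m hpm]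
  exact hcl

omit hint in
/-- **`E₀(K_w)[p] = 0` for the minimal model `W_ℤ ⊗ K_w` at the cyclotomic completion `K_w = ℚ(ζ_m)_w`, `w ∣ p ∤ m`,
under F″'s clause as typed** (`W/ℚ` globally minimal, `Addv W p`, `5 ≤ p`).
[cite: KostersPannekoek2017, Thm. 1 and Cor. 2] [cite: KimNakamura2020, Thm. 2.1, Remark 1.8 (1)] -/
theorem noPTorsion_Kw_of_katoClause (m : ℕ) [NeZero m] [IsCyclotomicExtension {m} ℚ L] (hpm : ¬ p ∣ m)
    (hp5 : 5 ≤ p) (hadd : Rank1Residual.Addv W p)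
    (hcl : 7 < p ∨ (Nat.Coprime (orderOf (p : ZMod m)) (p - 1) ∧
      ∀ P : (W.baseChange ℚ_[p]).toAffine.Point, p • P = 0 → P = 0))
    {P : (curveK p (Kw p L w) ((integralModelInt W).map (Int.castRingHom ℤ_[p]))).toAffine.Point}
    (hP : P ∈ (((integralModelInt W).map (Int.castRingHom ℤ_[p])).map (coeffHom p (Kw p L w))).nonsingularReductionSubgroup
      (Valuation.integer.integers (NormedField.valuation (K := Kw p L w))))
    (hpP : p • P = 0) : P = 0 := by
  haveI : IsGalois ℚ_[p] (Kw p L w) := Kw.isGalois (p := p) (L := L) (w := w) m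
  exact noPTorsion_of_addv_of_katoClause W hp5 hadd
    (fun z hz => by exact_mod_cast Kw.norm_le_norm_prime_of_norm_lt_one he.out z hz)
    (katoClause_Kw_of_katoClause p L w W m hpm hcl) hP hpP

/-- ★ **THE RECEPTACLE AT `K_w` (log side): `Λ̃ : E₀(K_w) ↠ 𝒪_w`** for `W_ℤ ⊗ K_w`, `K_w = ℚ(ζ_m)_w`, `w ∣ p ∤ m`,
under F″'s binders (`5 ≤ p`, `Addv W p`, clause as typed). [cite: KimNakamura2020, Thm. 2.1, Cor. 2.3]
[cite: KostersPannekoek2017, Thm. 1] -/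
theorem exists_mem_nonsingularReductionSubgroup_satLog_eq_Kw_of_katoClause (m : ℕ) [NeZero m]
    [IsCyclotomicExtension {m} ℚ L] (hpm : ¬ p ∣ m) (hp5 : 5 ≤ p) (hadd : Rank1Residual.Addv W p)
    (hcl : 7 < p ∨ (Nat.Coprime (orderOf (p : ZMod m)) (p - 1) ∧
      ∀ P : (W.baseChange ℚ_[p]).toAffine.Point, p • P = 0 → P = 0))
    {y : Kw p L w} (hy : ‖y‖ ≤ 1) :
    ∃ P ∈ (((integralModelInt W).map (Int.castRingHom ℤ_[p])).map (coeffHom p (Kw p L w))).nonsingularReductionSubgroup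
        (Valuation.integer.integers (NormedField.valuation (K := Kw p L w))),
      satLog p (Kw p L w) ((integralModelInt W).map (Int.castRingHom ℤ_[p])) P = y := by
  haveI : IsGalois ℚ_[p] (Kw p L w) := Kw.isGalois (p := p) (L := L) (w := w) m
  exact exists_mem_nonsingularReductionSubgroup_satLog_eq_of_addv_of_katoClause W hp5 hadd
    (fun z hz => by exact_mod_cast Kw.norm_le_norm_prime_of_norm_lt_one he.out z hz)
    (katoClause_Kw_of_katoClause p L w W m hpm hcl) hy

/-- ★ **THE RECEPTACLE EXIT AT `K_w`**: `W/ℚ` globally minimal, `Addv W p`, `5 ≤ p`, `L/ℚ` `{m}`-cyclotomic, `w ∣ p ∤ m`,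
F″'s clause as typed: if `‖Tr_{K_w/ℚ_p}(a · log_ω P)‖ ≤ 1` for every `P ∈ E(K_w)` of `W_ℤ ⊗ K_w` (the (S5b) range
condition, i.e. `a ∈ exp*_ω(H¹(K_w, T_pE))`), then **`‖a‖ ≤ 1`** — item 2 of F″'s derivation (`exp*_{ω_E}(loc_w z) ∈ 𝒪_w`,
Kim–Nakamura Cor. 2.4) as a theorem modulo (S5b), at every datum F″ quantifies over.
[cite: KimNakamura2020, Cor. 2.4] [cite: KostersPannekoek2017, Thm. 1 and Cor. 2] [cite: Kato2004Asterisque, (8.1.3), Thm. 9.7] -/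
theorem norm_le_one_of_forall_point_Kw_of_katoClause (m : ℕ) [NeZero m] [IsCyclotomicExtension {m} ℚ L]
    (hpm : ¬ p ∣ m) (hp5 : 5 ≤ p) (hadd : Rank1Residual.Addv W p)
    (hcl : 7 < p ∨ (Nat.Coprime (orderOf (p : ZMod m)) (p - 1) ∧
      ∀ P : (W.baseChange ℚ_[p]).toAffine.Point, p • P = 0 → P = 0))
    {a : Kw p L w}
    (ha : ∀ P : (curveK p (Kw p L w) ((integralModelInt W).map (Int.castRingHom ℤ_[p]))).toAffine.Point,
      ‖Algebra.trace ℚ_[p] (Kw p L w) (a * padicLogPointFiniteExt (NormedField.valuation (K := Kw p L w))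
        (curveK p (Kw p L w) ((integralModelInt W).map (Int.castRingHom ℤ_[p]))) p P)‖ ≤ 1) :
    ‖a‖ ≤ 1 := by
  haveI : IsGalois ℚ_[p] (Kw p L w) := Kw.isGalois (p := p) (L := L) (w := w) m
  exact norm_le_one_of_forall_point_of_addv_of_katoClause W hp5 hadd
    (fun z hz => by exact_mod_cast Kw.norm_le_norm_prime_of_norm_lt_one he.out z hz)
    (katoClause_Kw_of_katoClause p L w W m hpm hcl) ha

/-- (S5b)-socket form AT `K_w`: any `Φ : X → K_w` whose range is characterised by the trace condition takes values in
`𝒪_w` — `exp*_{e•ω}(H¹(K_w, T_pE)) ⊆ 𝒪_w`. [cite: KimNakamura2020, Cor. 2.4] -/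
theorem forall_norm_le_one_of_range_iff_forall_point_Kw_of_katoClause (m : ℕ) [NeZero m]
    [IsCyclotomicExtension {m} ℚ L] (hpm : ¬ p ∣ m) (hp5 : 5 ≤ p) (hadd : Rank1Residual.Addv W p)
    (hcl : 7 < p ∨ (Nat.Coprime (orderOf (p : ZMod m)) (p - 1) ∧
      ∀ P : (W.baseChange ℚ_[p]).toAffine.Point, p • P = 0 → P = 0))
    {X : Type*} (Φ : X → Kw p L w)
    (hΦ : ∀ a : Kw p L w, (∃ x, Φ x = a) ↔
      ∀ P : (curveK p (Kw p L w) ((integralModelInt W).map (Int.castRingHom ℤ_[p]))).toAffine.Point,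
        ‖Algebra.trace ℚ_[p] (Kw p L w) (a * padicLogPointFiniteExt (NormedField.valuation (K := Kw p L w))
          (curveK p (Kw p L w) ((integralModelInt W).map (Int.castRingHom ℤ_[p]))) p P)‖ ≤ 1)
    (x : X) : ‖Φ x‖ ≤ 1 :=
  norm_le_one_of_forall_point_Kw_of_katoClause p L w W m hpm hp5 hadd hcl ((hΦ (Φ x)).mp ⟨x, rfl⟩)

end Cyclotomic

end Summit.BirchSwinnertonDyer.BirchSwinnertonDyer.Theorems.ReceptacleTorsion

end
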